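import Mathlib
import HarnessLib
import Summits.ResolutionOfSingularities.ResolutionOfSingularities.Theorems.WildQuotientsWildQuotientResolutionS1aKillFamily

/-!
# S1a — MULTI-SUPPORT ROOTS (α1, step 1): a disjointly-supported finite family of ADMISSIBLE centres glues to ONE admissible centre `⨅ᵢ 𝒦ᵢ`

[OURS · L1 W4.5c · lead-1 g16; plan-1 RULING R-F15o (3) design (α1) «k-RATIONAL multi-support: … pairwise disjoint closed supports and the product (= intersection,
coprime) weighted filtration; near supp 𝒦ᵢ the other factors are units … the atlas is the union» — the ADMISSIBLE analogue of ✓`isPrincipalCentre_infRees_of_disjoint`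
(`…S1aKillFamily`, p614162) on top of ✓`isAdmissibleCentre_infRees` (`…S1aCentreGluing`, p612813) and ✓`exists_isCentreChart_le` (`…S1aPrincipalChartShrink`)] —
NOT statements of the manuscript; counted 0; AI-level work, weaker than expert review. Crux stmt-ResolutionOfSingularities-17941 `CyclicQuotientFourfolds`, line
`s1a-logminvertex` v13 (`stub_reachLowerInFX`). Route-independent infrastructure for the rungs R4c (cusp, `O ⊔ Q`), R4d (tacnode, `O ⊔ Q₊ ⊔ Q₋`), R4e.

* `exists_centreChart_at_support` — at a point of `supp 𝒦_{i₀}`: a centre chart of `𝒦_{i₀}` through the point, inside any given `G`-stable open, on which every other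
  member of the family is TRIVIAL;
* ★ `isAdmissibleCentre_infRees_of_disjoint` — finitely many admissible centres of one Veronese degree with pairwise disjoint supports glue to the admissible centre
  `⨅ᵢ 𝒦ᵢ`; `isCentreChart_infRees_of_disjoint` (a centre chart of `𝒦_{i₀}` missing the other supports is a centre chart of the glued centre),
  `filtration_infRees_eq_of_disjoint` (on an affine open missing the other supports the glued filtration IS `𝒦_{i₀}`'s), `support_infRees_subset` (`supp ⊆ ⋃ supp 𝒦ᵢ`).
-/

set_option linter.dupNamespace false

noncomputable section

universe u

open CategoryTheory Limits AlgebraicGeometry TopologicalSpace Topology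
open Literature.AlgebraicGeometry.Resolution Literature.AlgebraicGeometry.RelativeSpec
open Summit.ResolutionOfSingularities.ResolutionOfSingularities.Theorems.WildQuotientResolution.S1
open Summit.ResolutionOfSingularities.ResolutionOfSingularities.Theorems.WildQuotientResolution.S1.NodeAtlas
open Summit.ResolutionOfSingularities.ResolutionOfSingularities.Theorems.WildQuotientResolution.S1.BlowupCharts
open Summit.ResolutionOfSingularities.ResolutionOfSingularities.Theorems.WildQuotientResolution.S1.CentreGluing
open Summit.ResolutionOfSingularities.ResolutionOfSingularities.Theorems.WildQuotientResolution.S1.PrincipalChartShrink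
open Summit.ResolutionOfSingularities.ResolutionOfSingularities.Theorems.WildQuotientResolution.S1.NodeChartAway
open Summit.ResolutionOfSingularities.ResolutionOfSingularities.Theorems.WildQuotientResolution.S1.KillFamily

namespace Summit.ResolutionOfSingularities.ResolutionOfSingularities.Theorems.WildQuotientResolution.S1.MultiRoot

variable {p : ℕ} {X' X₁ : Scheme.{0}} {q : X' ⟶ X₁} {G : Type} [Group G] {ρ : G →* Aut X'} {g₀ : G} {ι : Type} [Finite ι]

/-- **AT A POINT OF `supp 𝒦_{i₀}`** (admissible family): a CENTRE chart of `𝒦_{i₀}` through `v`, inside any given `G`-stable open, on which every OTHER member of a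
disjointly-supported family of admissible centres is TRIVIAL. [OURS · L1 W4.5c · (α1)] -/
theorem exists_centreChart_at_support [Finite G] (M : GameFrame.GModel p q G ρ g₀) (𝒦 : ι → ReesFiltration M.V) {d : ℕ} (hd : 0 < d)
    (hadm : ∀ i, IsAdmissibleCentre p M.act g₀ (𝒦 i) d)
    (hdisj : Pairwise fun i j => Disjoint (((𝒦 i).ideal d).support : Set M.V) ((𝒦 j).ideal d).support)
    {i₀ : ι} {v : M.V} (hvs : v ∈ ((𝒦 i₀).ideal d).support) {U₀ : M.V.Opens} (hU₀ : ∀ g : G, (M.act.aut g).hom ⁻¹ᵁ U₀ = U₀) (hvU₀ : v ∈ U₀) :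
    ∃ O : M.act.StableAffineOpens, v ∈ O.1 ∧ O.1 ≤ U₀ ∧ IsCentreChart p M.act g₀ (𝒦 i₀) d O ∧
      (∀ j, j ≠ i₀ → Disjoint ((O.1 : Set M.V)) (((𝒦 j).ideal d).support : Set M.V)) ∧
      ∀ (hO : IsAffineOpen O.1) (j : ι), (∀ n, ((𝒦 j).filtration ⟨O.1, hO⟩).ideal n = ⊤) ∨
        ∀ n, ((𝒦 j).filtration ⟨O.1, hO⟩).ideal n = ((𝒦 i₀).filtration ⟨O.1, hO⟩).ideal n := by
  -- the chart of `𝒦 i₀` at `v` is a centre chart: an idle chart misses the support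
  obtain ⟨O, hvO, hO | hO⟩ := (hadm i₀).2.2 v
  swap
  · exact absurd hvs (Set.disjoint_left.mp
      (disjoint_support_of_ideal_eq_top hO.1.1 (by rw [← ReesFiltration.filtration_ideal]; exact hO.2 d)) hvO)
  -- shrink into `U₀ ∩ (off the other supports)`
  obtain ⟨U, hUmem, hUG⟩ := exists_stable_open_off M 𝒦 d (fun i g => (hadm i).2.1 g d) {j | j ≠ i₀}
  have hvU : v ∈ U := (hUmem v).mpr fun j hj hvj => Set.disjoint_left.mp (hdisj hj) hvj hvs
  obtain ⟨O'', hvO'', -, hO''U, -, hO''⟩ := exists_isCentreChart_le hO hvO hvs (U ⊓ U₀)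
    (fun g => by change (M.act.aut g).hom ⁻¹ᵁ U ⊓ (M.act.aut g).hom ⁻¹ᵁ U₀ = U ⊓ U₀; rw [hUG g, hU₀ g]) ⟨hvU, hvU₀⟩
  have hoff : ∀ j, j ≠ i₀ → Disjoint ((O''.1 : Set M.V)) (((𝒦 j).ideal d).support : Set M.V) := fun j hj => by
    rw [Set.disjoint_left]
    intro x hx hxj
    exact (hUmem x).mp (hO''U hx).1 j hj hxj
  refine ⟨O'', hvO'', fun x hx => (hO''U hx).2, hO'', hoff, fun hOa j => ?_⟩
  by_cases hj : j = i₀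
  · subst hj
    exact Or.inr fun n => rfl
  · exact Or.inl (filtration_eq_top_of_disjoint (𝒦 j) hd ⟨O''.1, hOa⟩ (hoff j hj))

/-- ★ **A DISJOINTLY-SUPPORTED FINITE FAMILY OF ADMISSIBLE CENTRES GLUES TO ONE ADMISSIBLE CENTRE** `⨅ᵢ 𝒦ᵢ` (same Veronese degree `d`).
[OURS · L1 W4.5c · (α1) multi-support roots] -/
theorem isAdmissibleCentre_infRees_of_disjoint [Finite G] (M : GameFrame.GModel p q G ρ g₀) (𝒦 : ι → ReesFiltration M.V) {d : ℕ} (hd : 0 < d)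
    (hadm : ∀ i, IsAdmissibleCentre p M.act g₀ (𝒦 i) d)
    (hdisj : Pairwise fun i j => Disjoint (((𝒦 i).ideal d).support : Set M.V) ((𝒦 j).ideal d).support) :
    IsAdmissibleCentre p M.act g₀ (infRees 𝒦) d := by
  have hGst : ∀ (i : ι) (g : G) (n : ℕ), ((𝒦 i).ideal n).comap (M.act.aut g).hom = (𝒦 i).ideal n := fun i g n => (hadm i).2.1 g n
  refine isAdmissibleCentre_infRees (ρ := M.act) (g₀ := g₀) 𝒦 hd hGst fun v => ?_
  by_cases h : ∃ i₀, v ∈ (((𝒦 i₀).ideal d).support : Set M.V)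
  · obtain ⟨i₀, hvs⟩ := h
    obtain ⟨O, hvO, -, hO, -, hj⟩ := exists_centreChart_at_support M 𝒦 hd hadm hdisj hvs (U₀ := ⊤) (fun g => Opens.map_top _) trivial
    exact ⟨O, hvO, Or.inl ⟨i₀, hO, hj⟩⟩
  · have h' : ∀ i, v ∉ (((𝒦 i).ideal d).support : Set M.V) := fun i hi => h ⟨i, hi⟩
    obtain ⟨O, hvO, hn, hj⟩ := exists_chart_off_support M 𝒦 hd (fun i g => hGst i g d) h'
    exact ⟨O, hvO, Or.inr ⟨hn, hj⟩⟩

/-- On an affine open missing the supports of all `𝒦ⱼ`, `j ≠ i₀`, the glued filtration IS the filtration of `𝒦_{i₀}` (degree by degree). -/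
theorem filtration_infRees_eq_of_disjoint {V : Scheme.{u}} (𝒦 : ι → ReesFiltration V) {d : ℕ} (hd : 0 < d) (U : V.affineOpens) (i₀ : ι)
    (hoff : ∀ j, j ≠ i₀ → Disjoint ((U.1 : Set V)) (((𝒦 j).ideal d).support : Set V)) (n : ℕ) :
    ((infRees 𝒦).filtration U).ideal n = ((𝒦 i₀).filtration U).ideal n := by
  refine filtration_infRees_eq 𝒦 U i₀ (fun j => ?_) n
  by_cases hj : j = i₀
  · subst hj; exact Or.inr fun n => rfl
  · exact Or.inl (filtration_eq_top_of_disjoint (𝒦 j) hd U (hoff j hj))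

/-- A centre chart of `𝒦_{i₀}` missing the supports of the other members is a centre chart of the glued centre. -/
theorem isCentreChart_infRees_of_disjoint {V Y : Scheme.{u}} {q' : V ⟶ Y} {G' : Type*} [Group G'] {ρ' : ActionOver q' G'} {g₀' : G'}
    (𝒦 : ι → ReesFiltration V) {d : ℕ} (hd : 0 < d) {O : ρ'.StableAffineOpens} (i₀ : ι) (hc : IsCentreChart p ρ' g₀' (𝒦 i₀) d O)
    (hoff : ∀ j, j ≠ i₀ → Disjoint ((O.1 : Set V)) (((𝒦 j).ideal d).support : Set V)) :
    IsCentreChart p ρ' g₀' (infRees 𝒦) d O :=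
  isCentreChart_congr hc fun hO n => filtration_infRees_eq_of_disjoint 𝒦 hd ⟨O.1, hO⟩ i₀ hoff n

/-- The support of a piece of the glued centre lies in the union of the supports of the members. -/
theorem support_infRees_subset {V : Scheme.{u}} (𝒦 : ι → ReesFiltration V) (n : ℕ) :
    ((((infRees 𝒦).ideal n).support : Set V)) ⊆ ⋃ i, ((((𝒦 i).ideal n).support : Set V)) := by
  classical
  intro x hx
  by_contra hne
  simp only [Set.mem_iUnion, not_exists] at hne
  -- at `x` every `𝒦ᵢ.ideal n` is the unit ideal on a small affine neighbourhood, hence so is the infimum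
  haveI : Fintype ι := Fintype.ofFinite ι
  obtain ⟨U, hxU, hU⟩ : ∃ U : V.affineOpens, x ∈ (U.1 : Set V) ∧ ∀ i, Disjoint ((U.1 : Set V)) ((((𝒦 i).ideal n).support : Set V)) := by
    have hopen : IsOpen (⋂ i, ((((𝒦 i).ideal n).support : Set V))ᶜ) := isOpen_iInter_of_finite fun i => ((𝒦 i).ideal n).support.isClosed.isOpen_compl
    have hxmem : x ∈ (⟨⋂ i, ((((𝒦 i).ideal n).support : Set V))ᶜ, hopen⟩ : V.Opens) := Set.mem_iInter.mpr fun i => hne i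
    obtain ⟨W, hWaff, hxW, hWle⟩ := (Opens.isBasis_iff_nbhd.mp V.isBasis_affineOpens) hxmem
    exact ⟨⟨W, hWaff⟩, hxW, fun i => Set.disjoint_left.mpr fun y hy hyi => (Set.mem_iInter.mp (hWle hy) i) hyi⟩
  have htop : ((infRees 𝒦).ideal n).ideal U = ⊤ := by
    rw [infRees_ideal, Scheme.IdealSheafData.ideal_iInf, iInf_apply]
    exact eq_top_iff.mpr (le_iInf fun i => (ideal_eq_top_of_disjoint_support _ U (hU i)).ge)
  exact Set.disjoint_left.mp (disjoint_support_of_ideal_eq_top U.2 htop) hxU hx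

end Summit.ResolutionOfSingularities.ResolutionOfSingularities.Theorems.WildQuotientResolution.S1.MultiRoot

end
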